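import Summits.CriticalPhenomena.Ising3DConformalLimit.Theorems.InversionUpgradeNormalised.Negative.WickEight
import Summits.CriticalPhenomena.Ising3DConformalLimit.Theorems.InversionUpgradeNormalised.Negative.AutomaticOrders

/-!
# `InversionUpgradeNormalised` (item stmt-CriticalPhenomena-1982): `S₈` Gaussian + RP ⇒ `S₄ = γ·wick` ⇒ inversion identity at order four

Standing crux disprover, cycle 3. The order-`(4,8)` instance of downward rigidity
(`DownwardRigidity.lean`): a reflection-positive (one axis), translation- and reflection-invariant
family `S` on `ℝ³` with `S₀ = 1` whose EIGHT-point function is the Gaussian `wick8 Δ` (`Δ > 0`) has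
`S₄ = γ · wick Δ` on all non-coincident configurations with `γ² ≤ 1`
(`exists_gamma_four_point_of_wick_eight`), hence — once normalised to `0` on coincident
configurations, as the crux's `S` is — satisfies the inversion identity at order four
(`invIdentity_four_of_wick_eight`). For the crux: an RP decoy (RP + Euclid + scale, NOT inversion
covariant) can not be Gaussian at order eight; iterating, not at orders `16, 32, …` either: every RP
decoy is non-Gaussian at all dyadic orders at once. No finite-order deformation of a generalized free
field is reflection positive (complements `SixPoint.lean` and `ReflectionPositiveOrders.lean`).

The OS clustering `K(a_L, b_L) → wick(a) wick(b)` (`tendsto_osEightExpr`) is the termwise limit of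
the `105` matchings: the `96` with a pair across the mirror die (`tendsto_twoPt_cross`).
-/

noncomputable section

namespace Summit.CriticalPhenomena.Ising3DConformalLimit.InversionUpgradeNormalisedNegative

open Literature.Probability.LatticeModels Literature.Barriers.CriticalPhenomena
open Literature.MathematicalPhysics.QuantumFieldTheory
open Filter Set Function ScaleNotMoebius EuclideanGeometry
open scoped Topology RealInnerProductSpace

/-- For a reflection-invariant, permutation-symmetric family the symmetrised OS kernel IS the OS
kernel (`osPointKernel_comm`), so `downward_rigidity` and its instances read directly on `K`
(as for the crux's `S`, whose limits of spin moments are symmetric). [folklore] -/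
theorem osSym_eq_osPointKernel {d : ℕ} {τ : Fin d} {S : CorrFamily d} (hR : IsReflectionInvariantAlong τ S)
    (hP : IsPermutationSymmetric S) (a b : HalfSpaceConfig d τ) : osSym S a b = osPointKernel S a b := by
  unfold osSym; rw [osPointKernel_comm hR hP b a]; ring

variable {τ : Fin 3}

local notation "E³" => EuclideanSpace ℝ (Fin 3)

/-- Its termwise limit as `L → ∞` (cross factors replaced by `0`). [folklore] -/
def osEightLim (Δ : ℝ) (a b : Fin 4 → E³) : ℝ :=
    twoPt Δ (a 0) (a 1) * twoPt Δ (a 2) (a 3) * twoPt Δ (b 0) (b 1) * twoPt Δ (b 2) (b 3) + twoPt Δ (a 0) (a 1) * twoPt Δ (a 2) (a 3) * twoPt Δ (b 0) (b 2) *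
    twoPt Δ (b 1) (b 3) + twoPt Δ (a 0) (a 1) * twoPt Δ (a 2) (a 3) * twoPt Δ (b 0) (b 3) * twoPt Δ (b 1) (b 2) + twoPt Δ (a 0) (a 1) * (0 : ℝ) * (0 : ℝ) *
    twoPt Δ (b 2) (b 3) + twoPt Δ (a 0) (a 1) * (0 : ℝ) * (0 : ℝ) * twoPt Δ (b 1) (b 3) + twoPt Δ (a 0) (a 1) * (0 : ℝ) * (0 : ℝ) * twoPt Δ (b 1) (b 2) + twoPt
    Δ (a 0) (a 1) * (0 : ℝ) * (0 : ℝ) * twoPt Δ (b 2) (b 3) + twoPt Δ (a 0) (a 1) * (0 : ℝ) * (0 : ℝ) * twoPt Δ (b 0) (b 3) + twoPt Δ (a 0) (a 1) * (0 : ℝ) * (0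
    : ℝ) * twoPt Δ (b 0) (b 2) + twoPt Δ (a 0) (a 1) * (0 : ℝ) * (0 : ℝ) * twoPt Δ (b 1) (b 3) + twoPt Δ (a 0) (a 1) * (0 : ℝ) * (0 : ℝ) * twoPt Δ (b 0) (b 3) +
    twoPt Δ (a 0) (a 1) * (0 : ℝ) * (0 : ℝ) * twoPt Δ (b 0) (b 1) + twoPt Δ (a 0) (a 1) * (0 : ℝ) * (0 : ℝ) * twoPt Δ (b 1) (b 2) + twoPt Δ (a 0) (a 1) * (0 :
    ℝ) * (0 : ℝ) * twoPt Δ (b 0) (b 2) + twoPt Δ (a 0) (a 1) * (0 : ℝ) * (0 : ℝ) * twoPt Δ (b 0) (b 1) + twoPt Δ (a 0) (a 2) * twoPt Δ (a 1) (a 3) * twoPt Δ (b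
    0) (b 1) * twoPt Δ (b 2) (b 3) + twoPt Δ (a 0) (a 2) * twoPt Δ (a 1) (a 3) * twoPt Δ (b 0) (b 2) * twoPt Δ (b 1) (b 3) + twoPt Δ (a 0) (a 2) * twoPt Δ (a 1)
    (a 3) * twoPt Δ (b 0) (b 3) * twoPt Δ (b 1) (b 2) + twoPt Δ (a 0) (a 2) * (0 : ℝ) * (0 : ℝ) * twoPt Δ (b 2) (b 3) + twoPt Δ (a 0) (a 2) * (0 : ℝ) * (0 : ℝ)
    * twoPt Δ (b 1) (b 3) + twoPt Δ (a 0) (a 2) * (0 : ℝ) * (0 : ℝ) * twoPt Δ (b 1) (b 2) + twoPt Δ (a 0) (a 2) * (0 : ℝ) * (0 : ℝ) * twoPt Δ (b 2) (b 3) +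
    twoPt Δ (a 0) (a 2) * (0 : ℝ) * (0 : ℝ) * twoPt Δ (b 0) (b 3) + twoPt Δ (a 0) (a 2) * (0 : ℝ) * (0 : ℝ) * twoPt Δ (b 0) (b 2) + twoPt Δ (a 0) (a 2) * (0 :
    ℝ) * (0 : ℝ) * twoPt Δ (b 1) (b 3) + twoPt Δ (a 0) (a 2) * (0 : ℝ) * (0 : ℝ) * twoPt Δ (b 0) (b 3) + twoPt Δ (a 0) (a 2) * (0 : ℝ) * (0 : ℝ) * twoPt Δ (b 0)
    (b 1) + twoPt Δ (a 0) (a 2) * (0 : ℝ) * (0 : ℝ) * twoPt Δ (b 1) (b 2) + twoPt Δ (a 0) (a 2) * (0 : ℝ) * (0 : ℝ) * twoPt Δ (b 0) (b 2) + twoPt Δ (a 0) (a 2)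
    * (0 : ℝ) * (0 : ℝ) * twoPt Δ (b 0) (b 1) + twoPt Δ (a 0) (a 3) * twoPt Δ (a 1) (a 2) * twoPt Δ (b 0) (b 1) * twoPt Δ (b 2) (b 3) + twoPt Δ (a 0) (a 3) *
    twoPt Δ (a 1) (a 2) * twoPt Δ (b 0) (b 2) * twoPt Δ (b 1) (b 3) + twoPt Δ (a 0) (a 3) * twoPt Δ (a 1) (a 2) * twoPt Δ (b 0) (b 3) * twoPt Δ (b 1) (b 2) +
    twoPt Δ (a 0) (a 3) * (0 : ℝ) * (0 : ℝ) * twoPt Δ (b 2) (b 3) + twoPt Δ (a 0) (a 3) * (0 : ℝ) * (0 : ℝ) * twoPt Δ (b 1) (b 3) + twoPt Δ (a 0) (a 3) * (0 :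
    ℝ) * (0 : ℝ) * twoPt Δ (b 1) (b 2) + twoPt Δ (a 0) (a 3) * (0 : ℝ) * (0 : ℝ) * twoPt Δ (b 2) (b 3) + twoPt Δ (a 0) (a 3) * (0 : ℝ) * (0 : ℝ) * twoPt Δ (b 0)
    (b 3) + twoPt Δ (a 0) (a 3) * (0 : ℝ) * (0 : ℝ) * twoPt Δ (b 0) (b 2) + twoPt Δ (a 0) (a 3) * (0 : ℝ) * (0 : ℝ) * twoPt Δ (b 1) (b 3) + twoPt Δ (a 0) (a 3)
    * (0 : ℝ) * (0 : ℝ) * twoPt Δ (b 0) (b 3) + twoPt Δ (a 0) (a 3) * (0 : ℝ) * (0 : ℝ) * twoPt Δ (b 0) (b 1) + twoPt Δ (a 0) (a 3) * (0 : ℝ) * (0 : ℝ) * twoPt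
    Δ (b 1) (b 2) + twoPt Δ (a 0) (a 3) * (0 : ℝ) * (0 : ℝ) * twoPt Δ (b 0) (b 2) + twoPt Δ (a 0) (a 3) * (0 : ℝ) * (0 : ℝ) * twoPt Δ (b 0) (b 1) + (0 : ℝ) *
    twoPt Δ (a 1) (a 2) * (0 : ℝ) * twoPt Δ (b 2) (b 3) + (0 : ℝ) * twoPt Δ (a 1) (a 2) * (0 : ℝ) * twoPt Δ (b 1) (b 3) + (0 : ℝ) * twoPt Δ (a 1) (a 2) * (0 :
    ℝ) * twoPt Δ (b 1) (b 2) + (0 : ℝ) * twoPt Δ (a 1) (a 3) * (0 : ℝ) * twoPt Δ (b 2) (b 3) + (0 : ℝ) * twoPt Δ (a 1) (a 3) * (0 : ℝ) * twoPt Δ (b 1) (b 3) +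
    (0 : ℝ) * twoPt Δ (a 1) (a 3) * (0 : ℝ) * twoPt Δ (b 1) (b 2) + (0 : ℝ) * (0 : ℝ) * twoPt Δ (a 2) (a 3) * twoPt Δ (b 2) (b 3) + (0 : ℝ) * (0 : ℝ) * (0 : ℝ)
    * (0 : ℝ) + (0 : ℝ) * (0 : ℝ) * (0 : ℝ) * (0 : ℝ) + (0 : ℝ) * (0 : ℝ) * twoPt Δ (a 2) (a 3) * twoPt Δ (b 1) (b 3) + (0 : ℝ) * (0 : ℝ) * (0 : ℝ) * (0 : ℝ) +
    (0 : ℝ) * (0 : ℝ) * (0 : ℝ) * (0 : ℝ) + (0 : ℝ) * (0 : ℝ) * twoPt Δ (a 2) (a 3) * twoPt Δ (b 1) (b 2) + (0 : ℝ) * (0 : ℝ) * (0 : ℝ) * (0 : ℝ) + (0 : ℝ) * (0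
    : ℝ) * (0 : ℝ) * (0 : ℝ) + (0 : ℝ) * twoPt Δ (a 1) (a 2) * (0 : ℝ) * twoPt Δ (b 2) (b 3) + (0 : ℝ) * twoPt Δ (a 1) (a 2) * (0 : ℝ) * twoPt Δ (b 0) (b 3) +
    (0 : ℝ) * twoPt Δ (a 1) (a 2) * (0 : ℝ) * twoPt Δ (b 0) (b 2) + (0 : ℝ) * twoPt Δ (a 1) (a 3) * (0 : ℝ) * twoPt Δ (b 2) (b 3) + (0 : ℝ) * twoPt Δ (a 1) (a
    3) * (0 : ℝ) * twoPt Δ (b 0) (b 3) + (0 : ℝ) * twoPt Δ (a 1) (a 3) * (0 : ℝ) * twoPt Δ (b 0) (b 2) + (0 : ℝ) * (0 : ℝ) * twoPt Δ (a 2) (a 3) * twoPt Δ (b 2)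
    (b 3) + (0 : ℝ) * (0 : ℝ) * (0 : ℝ) * (0 : ℝ) + (0 : ℝ) * (0 : ℝ) * (0 : ℝ) * (0 : ℝ) + (0 : ℝ) * (0 : ℝ) * twoPt Δ (a 2) (a 3) * twoPt Δ (b 0) (b 3) + (0 :
    ℝ) * (0 : ℝ) * (0 : ℝ) * (0 : ℝ) + (0 : ℝ) * (0 : ℝ) * (0 : ℝ) * (0 : ℝ) + (0 : ℝ) * (0 : ℝ) * twoPt Δ (a 2) (a 3) * twoPt Δ (b 0) (b 2) + (0 : ℝ) * (0 : ℝ)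
    * (0 : ℝ) * (0 : ℝ) + (0 : ℝ) * (0 : ℝ) * (0 : ℝ) * (0 : ℝ) + (0 : ℝ) * twoPt Δ (a 1) (a 2) * (0 : ℝ) * twoPt Δ (b 1) (b 3) + (0 : ℝ) * twoPt Δ (a 1) (a 2)
    * (0 : ℝ) * twoPt Δ (b 0) (b 3) + (0 : ℝ) * twoPt Δ (a 1) (a 2) * (0 : ℝ) * twoPt Δ (b 0) (b 1) + (0 : ℝ) * twoPt Δ (a 1) (a 3) * (0 : ℝ) * twoPt Δ (b 1) (b
    3) + (0 : ℝ) * twoPt Δ (a 1) (a 3) * (0 : ℝ) * twoPt Δ (b 0) (b 3) + (0 : ℝ) * twoPt Δ (a 1) (a 3) * (0 : ℝ) * twoPt Δ (b 0) (b 1) + (0 : ℝ) * (0 : ℝ) *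
    twoPt Δ (a 2) (a 3) * twoPt Δ (b 1) (b 3) + (0 : ℝ) * (0 : ℝ) * (0 : ℝ) * (0 : ℝ) + (0 : ℝ) * (0 : ℝ) * (0 : ℝ) * (0 : ℝ) + (0 : ℝ) * (0 : ℝ) * twoPt Δ (a
    2) (a 3) * twoPt Δ (b 0) (b 3) + (0 : ℝ) * (0 : ℝ) * (0 : ℝ) * (0 : ℝ) + (0 : ℝ) * (0 : ℝ) * (0 : ℝ) * (0 : ℝ) + (0 : ℝ) * (0 : ℝ) * twoPt Δ (a 2) (a 3) *
    twoPt Δ (b 0) (b 1) + (0 : ℝ) * (0 : ℝ) * (0 : ℝ) * (0 : ℝ) + (0 : ℝ) * (0 : ℝ) * (0 : ℝ) * (0 : ℝ) + (0 : ℝ) * twoPt Δ (a 1) (a 2) * (0 : ℝ) * twoPt Δ (b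
    1) (b 2) + (0 : ℝ) * twoPt Δ (a 1) (a 2) * (0 : ℝ) * twoPt Δ (b 0) (b 2) + (0 : ℝ) * twoPt Δ (a 1) (a 2) * (0 : ℝ) * twoPt Δ (b 0) (b 1) + (0 : ℝ) * twoPt Δ
    (a 1) (a 3) * (0 : ℝ) * twoPt Δ (b 1) (b 2) + (0 : ℝ) * twoPt Δ (a 1) (a 3) * (0 : ℝ) * twoPt Δ (b 0) (b 2) + (0 : ℝ) * twoPt Δ (a 1) (a 3) * (0 : ℝ) *
    twoPt Δ (b 0) (b 1) + (0 : ℝ) * (0 : ℝ) * twoPt Δ (a 2) (a 3) * twoPt Δ (b 1) (b 2) + (0 : ℝ) * (0 : ℝ) * (0 : ℝ) * (0 : ℝ) + (0 : ℝ) * (0 : ℝ) * (0 : ℝ) *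
    (0 : ℝ) + (0 : ℝ) * (0 : ℝ) * twoPt Δ (a 2) (a 3) * twoPt Δ (b 0) (b 2) + (0 : ℝ) * (0 : ℝ) * (0 : ℝ) * (0 : ℝ) + (0 : ℝ) * (0 : ℝ) * (0 : ℝ) * (0 : ℝ) + (0
    : ℝ) * (0 : ℝ) * twoPt Δ (a 2) (a 3) * twoPt Δ (b 0) (b 1) + (0 : ℝ) * (0 : ℝ) * (0 : ℝ) * (0 : ℝ) + (0 : ℝ) * (0 : ℝ) * (0 : ℝ) * (0 : ℝ)


/-- Only the `9 = 3 × 3` matchings without cross pairs survive, and they factor: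
`osEightLim Δ a b = wick Δ a · wick Δ b`. [folklore] -/
theorem osEightLim_eq (Δ : ℝ) (a b : Fin 4 → E³) : osEightLim Δ a b = wick Δ a * wick Δ b := by
  simp only [osEightLim, wick]; ring

/-- `wick Δ x > 0` at non-coincident configurations. [folklore] -/
theorem wick_pos_of_injective (Δ : ℝ) {x : Fin 4 → E³} (hx : Function.Injective x) : 0 < wick Δ x := by
  unfold wick
  have h01 := twoPt_pos Δ (hx.ne (show (0 : Fin 4) ≠ 1 by decide))
  have h23 := twoPt_pos Δ (hx.ne (show (2 : Fin 4) ≠ 3 by decide))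
  have h02 := twoPt_pos Δ (hx.ne (show (0 : Fin 4) ≠ 2 by decide))
  have h13 := twoPt_pos Δ (hx.ne (show (1 : Fin 4) ≠ 3 by decide))
  have h03 := twoPt_pos Δ (hx.ne (show (0 : Fin 4) ≠ 3 by decide))
  have h12 := twoPt_pos Δ (hx.ne (show (1 : Fin 4) ≠ 2 by decide))
  positivity

/-- `wick` is reflection invariant. [folklore] -/
theorem wick_reflect (Δ : ℝ) (x : Fin 4 → E³) : wick Δ (fun i => axisReflection τ (x i)) = wick Δ x := by
  simp only [wick, twoPt_map]

set_option maxRecDepth 8192 in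
/-- **The Gaussian OS clustering at orders `(4,8)`**, termwise (the proof term is a deep left-nested
chain of `Tendsto.add`/`Tendsto.mul` over the `105` matchings, whence the raised recursion limit). [folklore] -/
theorem tendsto_osEightExpr {Δ : ℝ} (hΔ : 0 < Δ) (a b : Fin 4 → E³) :
    Tendsto (osEightExpr Δ τ a b) atTop (𝓝 (osEightLim Δ a b)) := by
  unfold osEightExpr osEightLim
  exact
    (((((((((((((((((((((((((((((((((((((((((((((((((((((((((((((((((((((((((((((((((((((((((((((((((((((((((((tendsto_const_nhds.mul tendsto_const_nhds).mul
    tendsto_const_nhds).mul tendsto_const_nhds).add (((tendsto_const_nhds.mul tendsto_const_nhds).mul tendsto_const_nhds).mul tendsto_const_nhds)).add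
    (((tendsto_const_nhds.mul tendsto_const_nhds).mul tendsto_const_nhds).mul tendsto_const_nhds)).add (((tendsto_const_nhds.mul (tendsto_twoPt_cross hΔ (a 2)
    (b 0) (τ := τ))).mul (tendsto_twoPt_cross hΔ (a 3) (b 1) (τ := τ))).mul tendsto_const_nhds)).add (((tendsto_const_nhds.mul (tendsto_twoPt_cross hΔ (a 2) (b
    0) (τ := τ))).mul (tendsto_twoPt_cross hΔ (a 3) (b 2) (τ := τ))).mul tendsto_const_nhds)).add (((tendsto_const_nhds.mul (tendsto_twoPt_cross hΔ (a 2) (b 0)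
    (τ := τ))).mul (tendsto_twoPt_cross hΔ (a 3) (b 3) (τ := τ))).mul tendsto_const_nhds)).add (((tendsto_const_nhds.mul (tendsto_twoPt_cross hΔ (a 2) (b 1) (τ
    := τ))).mul (tendsto_twoPt_cross hΔ (a 3) (b 0) (τ := τ))).mul tendsto_const_nhds)).add (((tendsto_const_nhds.mul (tendsto_twoPt_cross hΔ (a 2) (b 1) (τ :=
    τ))).mul (tendsto_twoPt_cross hΔ (a 3) (b 2) (τ := τ))).mul tendsto_const_nhds)).add (((tendsto_const_nhds.mul (tendsto_twoPt_cross hΔ (a 2) (b 1) (τ :=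
    τ))).mul (tendsto_twoPt_cross hΔ (a 3) (b 3) (τ := τ))).mul tendsto_const_nhds)).add (((tendsto_const_nhds.mul (tendsto_twoPt_cross hΔ (a 2) (b 2) (τ :=
    τ))).mul (tendsto_twoPt_cross hΔ (a 3) (b 0) (τ := τ))).mul tendsto_const_nhds)).add (((tendsto_const_nhds.mul (tendsto_twoPt_cross hΔ (a 2) (b 2) (τ :=
    τ))).mul (tendsto_twoPt_cross hΔ (a 3) (b 1) (τ := τ))).mul tendsto_const_nhds)).add (((tendsto_const_nhds.mul (tendsto_twoPt_cross hΔ (a 2) (b 2) (τ :=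
    τ))).mul (tendsto_twoPt_cross hΔ (a 3) (b 3) (τ := τ))).mul tendsto_const_nhds)).add (((tendsto_const_nhds.mul (tendsto_twoPt_cross hΔ (a 2) (b 3) (τ :=
    τ))).mul (tendsto_twoPt_cross hΔ (a 3) (b 0) (τ := τ))).mul tendsto_const_nhds)).add (((tendsto_const_nhds.mul (tendsto_twoPt_cross hΔ (a 2) (b 3) (τ :=
    τ))).mul (tendsto_twoPt_cross hΔ (a 3) (b 1) (τ := τ))).mul tendsto_const_nhds)).add (((tendsto_const_nhds.mul (tendsto_twoPt_cross hΔ (a 2) (b 3) (τ :=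
    τ))).mul (tendsto_twoPt_cross hΔ (a 3) (b 2) (τ := τ))).mul tendsto_const_nhds)).add (((tendsto_const_nhds.mul tendsto_const_nhds).mul
    tendsto_const_nhds).mul tendsto_const_nhds)).add (((tendsto_const_nhds.mul tendsto_const_nhds).mul tendsto_const_nhds).mul tendsto_const_nhds)).add
    (((tendsto_const_nhds.mul tendsto_const_nhds).mul tendsto_const_nhds).mul tendsto_const_nhds)).add (((tendsto_const_nhds.mul (tendsto_twoPt_cross hΔ (a 1)
    (b 0) (τ := τ))).mul (tendsto_twoPt_cross hΔ (a 3) (b 1) (τ := τ))).mul tendsto_const_nhds)).add (((tendsto_const_nhds.mul (tendsto_twoPt_cross hΔ (a 1) (b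
    0) (τ := τ))).mul (tendsto_twoPt_cross hΔ (a 3) (b 2) (τ := τ))).mul tendsto_const_nhds)).add (((tendsto_const_nhds.mul (tendsto_twoPt_cross hΔ (a 1) (b 0)
    (τ := τ))).mul (tendsto_twoPt_cross hΔ (a 3) (b 3) (τ := τ))).mul tendsto_const_nhds)).add (((tendsto_const_nhds.mul (tendsto_twoPt_cross hΔ (a 1) (b 1) (τ
    := τ))).mul (tendsto_twoPt_cross hΔ (a 3) (b 0) (τ := τ))).mul tendsto_const_nhds)).add (((tendsto_const_nhds.mul (tendsto_twoPt_cross hΔ (a 1) (b 1) (τ :=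
    τ))).mul (tendsto_twoPt_cross hΔ (a 3) (b 2) (τ := τ))).mul tendsto_const_nhds)).add (((tendsto_const_nhds.mul (tendsto_twoPt_cross hΔ (a 1) (b 1) (τ :=
    τ))).mul (tendsto_twoPt_cross hΔ (a 3) (b 3) (τ := τ))).mul tendsto_const_nhds)).add (((tendsto_const_nhds.mul (tendsto_twoPt_cross hΔ (a 1) (b 2) (τ :=
    τ))).mul (tendsto_twoPt_cross hΔ (a 3) (b 0) (τ := τ))).mul tendsto_const_nhds)).add (((tendsto_const_nhds.mul (tendsto_twoPt_cross hΔ (a 1) (b 2) (τ :=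
    τ))).mul (tendsto_twoPt_cross hΔ (a 3) (b 1) (τ := τ))).mul tendsto_const_nhds)).add (((tendsto_const_nhds.mul (tendsto_twoPt_cross hΔ (a 1) (b 2) (τ :=
    τ))).mul (tendsto_twoPt_cross hΔ (a 3) (b 3) (τ := τ))).mul tendsto_const_nhds)).add (((tendsto_const_nhds.mul (tendsto_twoPt_cross hΔ (a 1) (b 3) (τ :=
    τ))).mul (tendsto_twoPt_cross hΔ (a 3) (b 0) (τ := τ))).mul tendsto_const_nhds)).add (((tendsto_const_nhds.mul (tendsto_twoPt_cross hΔ (a 1) (b 3) (τ :=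
    τ))).mul (tendsto_twoPt_cross hΔ (a 3) (b 1) (τ := τ))).mul tendsto_const_nhds)).add (((tendsto_const_nhds.mul (tendsto_twoPt_cross hΔ (a 1) (b 3) (τ :=
    τ))).mul (tendsto_twoPt_cross hΔ (a 3) (b 2) (τ := τ))).mul tendsto_const_nhds)).add (((tendsto_const_nhds.mul tendsto_const_nhds).mul
    tendsto_const_nhds).mul tendsto_const_nhds)).add (((tendsto_const_nhds.mul tendsto_const_nhds).mul tendsto_const_nhds).mul tendsto_const_nhds)).add
    (((tendsto_const_nhds.mul tendsto_const_nhds).mul tendsto_const_nhds).mul tendsto_const_nhds)).add (((tendsto_const_nhds.mul (tendsto_twoPt_cross hΔ (a 1)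
    (b 0) (τ := τ))).mul (tendsto_twoPt_cross hΔ (a 2) (b 1) (τ := τ))).mul tendsto_const_nhds)).add (((tendsto_const_nhds.mul (tendsto_twoPt_cross hΔ (a 1) (b
    0) (τ := τ))).mul (tendsto_twoPt_cross hΔ (a 2) (b 2) (τ := τ))).mul tendsto_const_nhds)).add (((tendsto_const_nhds.mul (tendsto_twoPt_cross hΔ (a 1) (b 0)
    (τ := τ))).mul (tendsto_twoPt_cross hΔ (a 2) (b 3) (τ := τ))).mul tendsto_const_nhds)).add (((tendsto_const_nhds.mul (tendsto_twoPt_cross hΔ (a 1) (b 1) (τ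
    := τ))).mul (tendsto_twoPt_cross hΔ (a 2) (b 0) (τ := τ))).mul tendsto_const_nhds)).add (((tendsto_const_nhds.mul (tendsto_twoPt_cross hΔ (a 1) (b 1) (τ :=
    τ))).mul (tendsto_twoPt_cross hΔ (a 2) (b 2) (τ := τ))).mul tendsto_const_nhds)).add (((tendsto_const_nhds.mul (tendsto_twoPt_cross hΔ (a 1) (b 1) (τ :=
    τ))).mul (tendsto_twoPt_cross hΔ (a 2) (b 3) (τ := τ))).mul tendsto_const_nhds)).add (((tendsto_const_nhds.mul (tendsto_twoPt_cross hΔ (a 1) (b 2) (τ :=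
    τ))).mul (tendsto_twoPt_cross hΔ (a 2) (b 0) (τ := τ))).mul tendsto_const_nhds)).add (((tendsto_const_nhds.mul (tendsto_twoPt_cross hΔ (a 1) (b 2) (τ :=
    τ))).mul (tendsto_twoPt_cross hΔ (a 2) (b 1) (τ := τ))).mul tendsto_const_nhds)).add (((tendsto_const_nhds.mul (tendsto_twoPt_cross hΔ (a 1) (b 2) (τ :=
    τ))).mul (tendsto_twoPt_cross hΔ (a 2) (b 3) (τ := τ))).mul tendsto_const_nhds)).add (((tendsto_const_nhds.mul (tendsto_twoPt_cross hΔ (a 1) (b 3) (τ :=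
    τ))).mul (tendsto_twoPt_cross hΔ (a 2) (b 0) (τ := τ))).mul tendsto_const_nhds)).add (((tendsto_const_nhds.mul (tendsto_twoPt_cross hΔ (a 1) (b 3) (τ :=
    τ))).mul (tendsto_twoPt_cross hΔ (a 2) (b 1) (τ := τ))).mul tendsto_const_nhds)).add (((tendsto_const_nhds.mul (tendsto_twoPt_cross hΔ (a 1) (b 3) (τ :=
    τ))).mul (tendsto_twoPt_cross hΔ (a 2) (b 2) (τ := τ))).mul tendsto_const_nhds)).add ((((tendsto_twoPt_cross hΔ (a 0) (b 0) (τ := τ)).mul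
    tendsto_const_nhds).mul (tendsto_twoPt_cross hΔ (a 3) (b 1) (τ := τ))).mul tendsto_const_nhds)).add ((((tendsto_twoPt_cross hΔ (a 0) (b 0) (τ := τ)).mul
    tendsto_const_nhds).mul (tendsto_twoPt_cross hΔ (a 3) (b 2) (τ := τ))).mul tendsto_const_nhds)).add ((((tendsto_twoPt_cross hΔ (a 0) (b 0) (τ := τ)).mul
    tendsto_const_nhds).mul (tendsto_twoPt_cross hΔ (a 3) (b 3) (τ := τ))).mul tendsto_const_nhds)).add ((((tendsto_twoPt_cross hΔ (a 0) (b 0) (τ := τ)).mul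
    tendsto_const_nhds).mul (tendsto_twoPt_cross hΔ (a 2) (b 1) (τ := τ))).mul tendsto_const_nhds)).add ((((tendsto_twoPt_cross hΔ (a 0) (b 0) (τ := τ)).mul
    tendsto_const_nhds).mul (tendsto_twoPt_cross hΔ (a 2) (b 2) (τ := τ))).mul tendsto_const_nhds)).add ((((tendsto_twoPt_cross hΔ (a 0) (b 0) (τ := τ)).mul
    tendsto_const_nhds).mul (tendsto_twoPt_cross hΔ (a 2) (b 3) (τ := τ))).mul tendsto_const_nhds)).add ((((tendsto_twoPt_cross hΔ (a 0) (b 0) (τ := τ)).mul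
    (tendsto_twoPt_cross hΔ (a 1) (b 1) (τ := τ))).mul tendsto_const_nhds).mul tendsto_const_nhds)).add ((((tendsto_twoPt_cross hΔ (a 0) (b 0) (τ := τ)).mul
    (tendsto_twoPt_cross hΔ (a 1) (b 1) (τ := τ))).mul (tendsto_twoPt_cross hΔ (a 2) (b 2) (τ := τ))).mul (tendsto_twoPt_cross hΔ (a 3) (b 3) (τ := τ)))).add
    ((((tendsto_twoPt_cross hΔ (a 0) (b 0) (τ := τ)).mul (tendsto_twoPt_cross hΔ (a 1) (b 1) (τ := τ))).mul (tendsto_twoPt_cross hΔ (a 2) (b 3) (τ := τ))).mul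
    (tendsto_twoPt_cross hΔ (a 3) (b 2) (τ := τ)))).add ((((tendsto_twoPt_cross hΔ (a 0) (b 0) (τ := τ)).mul (tendsto_twoPt_cross hΔ (a 1) (b 2) (τ := τ))).mul
    tendsto_const_nhds).mul tendsto_const_nhds)).add ((((tendsto_twoPt_cross hΔ (a 0) (b 0) (τ := τ)).mul (tendsto_twoPt_cross hΔ (a 1) (b 2) (τ := τ))).mul
    (tendsto_twoPt_cross hΔ (a 2) (b 1) (τ := τ))).mul (tendsto_twoPt_cross hΔ (a 3) (b 3) (τ := τ)))).add ((((tendsto_twoPt_cross hΔ (a 0) (b 0) (τ := τ)).mul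
    (tendsto_twoPt_cross hΔ (a 1) (b 2) (τ := τ))).mul (tendsto_twoPt_cross hΔ (a 2) (b 3) (τ := τ))).mul (tendsto_twoPt_cross hΔ (a 3) (b 1) (τ := τ)))).add
    ((((tendsto_twoPt_cross hΔ (a 0) (b 0) (τ := τ)).mul (tendsto_twoPt_cross hΔ (a 1) (b 3) (τ := τ))).mul tendsto_const_nhds).mul tendsto_const_nhds)).add
    ((((tendsto_twoPt_cross hΔ (a 0) (b 0) (τ := τ)).mul (tendsto_twoPt_cross hΔ (a 1) (b 3) (τ := τ))).mul (tendsto_twoPt_cross hΔ (a 2) (b 1) (τ := τ))).mul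
    (tendsto_twoPt_cross hΔ (a 3) (b 2) (τ := τ)))).add ((((tendsto_twoPt_cross hΔ (a 0) (b 0) (τ := τ)).mul (tendsto_twoPt_cross hΔ (a 1) (b 3) (τ := τ))).mul
    (tendsto_twoPt_cross hΔ (a 2) (b 2) (τ := τ))).mul (tendsto_twoPt_cross hΔ (a 3) (b 1) (τ := τ)))).add ((((tendsto_twoPt_cross hΔ (a 0) (b 1) (τ := τ)).mul
    tendsto_const_nhds).mul (tendsto_twoPt_cross hΔ (a 3) (b 0) (τ := τ))).mul tendsto_const_nhds)).add ((((tendsto_twoPt_cross hΔ (a 0) (b 1) (τ := τ)).mul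
    tendsto_const_nhds).mul (tendsto_twoPt_cross hΔ (a 3) (b 2) (τ := τ))).mul tendsto_const_nhds)).add ((((tendsto_twoPt_cross hΔ (a 0) (b 1) (τ := τ)).mul
    tendsto_const_nhds).mul (tendsto_twoPt_cross hΔ (a 3) (b 3) (τ := τ))).mul tendsto_const_nhds)).add ((((tendsto_twoPt_cross hΔ (a 0) (b 1) (τ := τ)).mul
    tendsto_const_nhds).mul (tendsto_twoPt_cross hΔ (a 2) (b 0) (τ := τ))).mul tendsto_const_nhds)).add ((((tendsto_twoPt_cross hΔ (a 0) (b 1) (τ := τ)).mul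
    tendsto_const_nhds).mul (tendsto_twoPt_cross hΔ (a 2) (b 2) (τ := τ))).mul tendsto_const_nhds)).add ((((tendsto_twoPt_cross hΔ (a 0) (b 1) (τ := τ)).mul
    tendsto_const_nhds).mul (tendsto_twoPt_cross hΔ (a 2) (b 3) (τ := τ))).mul tendsto_const_nhds)).add ((((tendsto_twoPt_cross hΔ (a 0) (b 1) (τ := τ)).mul
    (tendsto_twoPt_cross hΔ (a 1) (b 0) (τ := τ))).mul tendsto_const_nhds).mul tendsto_const_nhds)).add ((((tendsto_twoPt_cross hΔ (a 0) (b 1) (τ := τ)).mul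
    (tendsto_twoPt_cross hΔ (a 1) (b 0) (τ := τ))).mul (tendsto_twoPt_cross hΔ (a 2) (b 2) (τ := τ))).mul (tendsto_twoPt_cross hΔ (a 3) (b 3) (τ := τ)))).add
    ((((tendsto_twoPt_cross hΔ (a 0) (b 1) (τ := τ)).mul (tendsto_twoPt_cross hΔ (a 1) (b 0) (τ := τ))).mul (tendsto_twoPt_cross hΔ (a 2) (b 3) (τ := τ))).mul
    (tendsto_twoPt_cross hΔ (a 3) (b 2) (τ := τ)))).add ((((tendsto_twoPt_cross hΔ (a 0) (b 1) (τ := τ)).mul (tendsto_twoPt_cross hΔ (a 1) (b 2) (τ := τ))).mul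
    tendsto_const_nhds).mul tendsto_const_nhds)).add ((((tendsto_twoPt_cross hΔ (a 0) (b 1) (τ := τ)).mul (tendsto_twoPt_cross hΔ (a 1) (b 2) (τ := τ))).mul
    (tendsto_twoPt_cross hΔ (a 2) (b 0) (τ := τ))).mul (tendsto_twoPt_cross hΔ (a 3) (b 3) (τ := τ)))).add ((((tendsto_twoPt_cross hΔ (a 0) (b 1) (τ := τ)).mul
    (tendsto_twoPt_cross hΔ (a 1) (b 2) (τ := τ))).mul (tendsto_twoPt_cross hΔ (a 2) (b 3) (τ := τ))).mul (tendsto_twoPt_cross hΔ (a 3) (b 0) (τ := τ)))).add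
    ((((tendsto_twoPt_cross hΔ (a 0) (b 1) (τ := τ)).mul (tendsto_twoPt_cross hΔ (a 1) (b 3) (τ := τ))).mul tendsto_const_nhds).mul tendsto_const_nhds)).add
    ((((tendsto_twoPt_cross hΔ (a 0) (b 1) (τ := τ)).mul (tendsto_twoPt_cross hΔ (a 1) (b 3) (τ := τ))).mul (tendsto_twoPt_cross hΔ (a 2) (b 0) (τ := τ))).mul
    (tendsto_twoPt_cross hΔ (a 3) (b 2) (τ := τ)))).add ((((tendsto_twoPt_cross hΔ (a 0) (b 1) (τ := τ)).mul (tendsto_twoPt_cross hΔ (a 1) (b 3) (τ := τ))).mul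
    (tendsto_twoPt_cross hΔ (a 2) (b 2) (τ := τ))).mul (tendsto_twoPt_cross hΔ (a 3) (b 0) (τ := τ)))).add ((((tendsto_twoPt_cross hΔ (a 0) (b 2) (τ := τ)).mul
    tendsto_const_nhds).mul (tendsto_twoPt_cross hΔ (a 3) (b 0) (τ := τ))).mul tendsto_const_nhds)).add ((((tendsto_twoPt_cross hΔ (a 0) (b 2) (τ := τ)).mul
    tendsto_const_nhds).mul (tendsto_twoPt_cross hΔ (a 3) (b 1) (τ := τ))).mul tendsto_const_nhds)).add ((((tendsto_twoPt_cross hΔ (a 0) (b 2) (τ := τ)).mul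
    tendsto_const_nhds).mul (tendsto_twoPt_cross hΔ (a 3) (b 3) (τ := τ))).mul tendsto_const_nhds)).add ((((tendsto_twoPt_cross hΔ (a 0) (b 2) (τ := τ)).mul
    tendsto_const_nhds).mul (tendsto_twoPt_cross hΔ (a 2) (b 0) (τ := τ))).mul tendsto_const_nhds)).add ((((tendsto_twoPt_cross hΔ (a 0) (b 2) (τ := τ)).mul
    tendsto_const_nhds).mul (tendsto_twoPt_cross hΔ (a 2) (b 1) (τ := τ))).mul tendsto_const_nhds)).add ((((tendsto_twoPt_cross hΔ (a 0) (b 2) (τ := τ)).mul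
    tendsto_const_nhds).mul (tendsto_twoPt_cross hΔ (a 2) (b 3) (τ := τ))).mul tendsto_const_nhds)).add ((((tendsto_twoPt_cross hΔ (a 0) (b 2) (τ := τ)).mul
    (tendsto_twoPt_cross hΔ (a 1) (b 0) (τ := τ))).mul tendsto_const_nhds).mul tendsto_const_nhds)).add ((((tendsto_twoPt_cross hΔ (a 0) (b 2) (τ := τ)).mul
    (tendsto_twoPt_cross hΔ (a 1) (b 0) (τ := τ))).mul (tendsto_twoPt_cross hΔ (a 2) (b 1) (τ := τ))).mul (tendsto_twoPt_cross hΔ (a 3) (b 3) (τ := τ)))).add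
    ((((tendsto_twoPt_cross hΔ (a 0) (b 2) (τ := τ)).mul (tendsto_twoPt_cross hΔ (a 1) (b 0) (τ := τ))).mul (tendsto_twoPt_cross hΔ (a 2) (b 3) (τ := τ))).mul
    (tendsto_twoPt_cross hΔ (a 3) (b 1) (τ := τ)))).add ((((tendsto_twoPt_cross hΔ (a 0) (b 2) (τ := τ)).mul (tendsto_twoPt_cross hΔ (a 1) (b 1) (τ := τ))).mul
    tendsto_const_nhds).mul tendsto_const_nhds)).add ((((tendsto_twoPt_cross hΔ (a 0) (b 2) (τ := τ)).mul (tendsto_twoPt_cross hΔ (a 1) (b 1) (τ := τ))).mul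
    (tendsto_twoPt_cross hΔ (a 2) (b 0) (τ := τ))).mul (tendsto_twoPt_cross hΔ (a 3) (b 3) (τ := τ)))).add ((((tendsto_twoPt_cross hΔ (a 0) (b 2) (τ := τ)).mul
    (tendsto_twoPt_cross hΔ (a 1) (b 1) (τ := τ))).mul (tendsto_twoPt_cross hΔ (a 2) (b 3) (τ := τ))).mul (tendsto_twoPt_cross hΔ (a 3) (b 0) (τ := τ)))).add
    ((((tendsto_twoPt_cross hΔ (a 0) (b 2) (τ := τ)).mul (tendsto_twoPt_cross hΔ (a 1) (b 3) (τ := τ))).mul tendsto_const_nhds).mul tendsto_const_nhds)).add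
    ((((tendsto_twoPt_cross hΔ (a 0) (b 2) (τ := τ)).mul (tendsto_twoPt_cross hΔ (a 1) (b 3) (τ := τ))).mul (tendsto_twoPt_cross hΔ (a 2) (b 0) (τ := τ))).mul
    (tendsto_twoPt_cross hΔ (a 3) (b 1) (τ := τ)))).add ((((tendsto_twoPt_cross hΔ (a 0) (b 2) (τ := τ)).mul (tendsto_twoPt_cross hΔ (a 1) (b 3) (τ := τ))).mul
    (tendsto_twoPt_cross hΔ (a 2) (b 1) (τ := τ))).mul (tendsto_twoPt_cross hΔ (a 3) (b 0) (τ := τ)))).add ((((tendsto_twoPt_cross hΔ (a 0) (b 3) (τ := τ)).mul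
    tendsto_const_nhds).mul (tendsto_twoPt_cross hΔ (a 3) (b 0) (τ := τ))).mul tendsto_const_nhds)).add ((((tendsto_twoPt_cross hΔ (a 0) (b 3) (τ := τ)).mul
    tendsto_const_nhds).mul (tendsto_twoPt_cross hΔ (a 3) (b 1) (τ := τ))).mul tendsto_const_nhds)).add ((((tendsto_twoPt_cross hΔ (a 0) (b 3) (τ := τ)).mul
    tendsto_const_nhds).mul (tendsto_twoPt_cross hΔ (a 3) (b 2) (τ := τ))).mul tendsto_const_nhds)).add ((((tendsto_twoPt_cross hΔ (a 0) (b 3) (τ := τ)).mul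
    tendsto_const_nhds).mul (tendsto_twoPt_cross hΔ (a 2) (b 0) (τ := τ))).mul tendsto_const_nhds)).add ((((tendsto_twoPt_cross hΔ (a 0) (b 3) (τ := τ)).mul
    tendsto_const_nhds).mul (tendsto_twoPt_cross hΔ (a 2) (b 1) (τ := τ))).mul tendsto_const_nhds)).add ((((tendsto_twoPt_cross hΔ (a 0) (b 3) (τ := τ)).mul
    tendsto_const_nhds).mul (tendsto_twoPt_cross hΔ (a 2) (b 2) (τ := τ))).mul tendsto_const_nhds)).add ((((tendsto_twoPt_cross hΔ (a 0) (b 3) (τ := τ)).mul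
    (tendsto_twoPt_cross hΔ (a 1) (b 0) (τ := τ))).mul tendsto_const_nhds).mul tendsto_const_nhds)).add ((((tendsto_twoPt_cross hΔ (a 0) (b 3) (τ := τ)).mul
    (tendsto_twoPt_cross hΔ (a 1) (b 0) (τ := τ))).mul (tendsto_twoPt_cross hΔ (a 2) (b 1) (τ := τ))).mul (tendsto_twoPt_cross hΔ (a 3) (b 2) (τ := τ)))).add
    ((((tendsto_twoPt_cross hΔ (a 0) (b 3) (τ := τ)).mul (tendsto_twoPt_cross hΔ (a 1) (b 0) (τ := τ))).mul (tendsto_twoPt_cross hΔ (a 2) (b 2) (τ := τ))).mul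
    (tendsto_twoPt_cross hΔ (a 3) (b 1) (τ := τ)))).add ((((tendsto_twoPt_cross hΔ (a 0) (b 3) (τ := τ)).mul (tendsto_twoPt_cross hΔ (a 1) (b 1) (τ := τ))).mul
    tendsto_const_nhds).mul tendsto_const_nhds)).add ((((tendsto_twoPt_cross hΔ (a 0) (b 3) (τ := τ)).mul (tendsto_twoPt_cross hΔ (a 1) (b 1) (τ := τ))).mul
    (tendsto_twoPt_cross hΔ (a 2) (b 0) (τ := τ))).mul (tendsto_twoPt_cross hΔ (a 3) (b 2) (τ := τ)))).add ((((tendsto_twoPt_cross hΔ (a 0) (b 3) (τ := τ)).mul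
    (tendsto_twoPt_cross hΔ (a 1) (b 1) (τ := τ))).mul (tendsto_twoPt_cross hΔ (a 2) (b 2) (τ := τ))).mul (tendsto_twoPt_cross hΔ (a 3) (b 0) (τ := τ)))).add
    ((((tendsto_twoPt_cross hΔ (a 0) (b 3) (τ := τ)).mul (tendsto_twoPt_cross hΔ (a 1) (b 2) (τ := τ))).mul tendsto_const_nhds).mul tendsto_const_nhds)).add
    ((((tendsto_twoPt_cross hΔ (a 0) (b 3) (τ := τ)).mul (tendsto_twoPt_cross hΔ (a 1) (b 2) (τ := τ))).mul (tendsto_twoPt_cross hΔ (a 2) (b 0) (τ := τ))).mul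
    (tendsto_twoPt_cross hΔ (a 3) (b 1) (τ := τ)))).add ((((tendsto_twoPt_cross hΔ (a 0) (b 3) (τ := τ)).mul (tendsto_twoPt_cross hΔ (a 1) (b 2) (τ := τ))).mul
    (tendsto_twoPt_cross hΔ (a 2) (b 1) (τ := τ))).mul (tendsto_twoPt_cross hΔ (a 3) (b 0) (τ := τ))))


/-- `K(a_L, b_L) → wick Δ a · wick Δ b` when `S₈ = wick8 Δ`. [folklore] -/
theorem tendsto_osPointKernel_cfg4 {S : CorrFamily 3} {Δ : ℝ} (hΔ : 0 < Δ)
    (h8 : ∀ x : Fin 8 → E³, Function.Injective x → S 8 x = wick8 Δ x)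
    {a b : Fin 4 → E³} (ha : ∀ i, 0 < a i τ) (hai : Function.Injective a)
    (hb : ∀ i, 0 < b i τ) (hbi : Function.Injective b) :
    Tendsto (fun L => osPointKernel S ((cfg4 a ha hai).timeShift L) ((cfg4 b hb hbi).timeShift L))
      atTop (𝓝 (wick Δ a * wick Δ b)) := by
  rw [← osEightLim_eq]
  refine (tendsto_osEightExpr (τ := τ) hΔ a b).congr' ?_
  filter_upwards [eventually_ge_atTop (0 : ℝ)] with L hL
  exact (osPointKernel_cfg4_eq_osEightExpr h8 ha hai hb hbi hL).symm

/-- **DOWNWARD RIGIDITY, Gaussian instance at orders `(4,8)`.** `S₄(a)/wick Δ a` is CONSTANT over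
four-point configurations in the half-space. [folklore] -/
theorem wick8_downward_four {S : CorrFamily 3} {Δ : ℝ} (hΔ : 0 < Δ)
    (hRP : IsReflectionPositiveAlong τ S) (hT : IsTranslationInvariant S)
    (hR : IsReflectionInvariantAlong τ S) (h0 : ∀ x, S 0 x = 1)
    (h8 : ∀ x : Fin 8 → E³, Function.Injective x → S 8 x = wick8 Δ x)
    {a b : Fin 4 → E³} (ha : ∀ i, 0 < a i τ) (hai : Function.Injective a)
    (hb : ∀ i, 0 < b i τ) (hbi : Function.Injective b) :
    S 4 a / wick Δ a = S 4 b / wick Δ b := by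
  have hBsym : Tendsto (fun L => osSym S ((cfg4 a ha hai).timeShift L) ((cfg4 b hb hbi).timeShift L))
      atTop (𝓝 (wick Δ a * wick Δ b)) := by
    have h := ((tendsto_osPointKernel_cfg4 hΔ h8 ha hai hb hbi (τ := τ)).add
      (tendsto_osPointKernel_cfg4 hΔ h8 hb hbi ha hai (τ := τ))).div_const 2
    have e : (wick Δ a * wick Δ b + wick Δ b * wick Δ a) / 2 = wick Δ a * wick Δ b := by ring
    rw [e] at h
    exact h
  have key := downward_rigidity hRP (osPointKernel_empty_empty S h0)
    (cfg4 a ha hai) (cfg4 b hb hbi) (wick_pos_of_injective Δ hai).ne' (wick_pos_of_injective Δ hbi).ne'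
    (fun L hL => osSym_empty_timeShift S hT hR _ hL) (fun L hL => osSym_empty_timeShift S hT hR _ hL)
    (by simpa [sq] using tendsto_osPointKernel_cfg4 hΔ h8 ha hai ha hai (τ := τ))
    hBsym
    (by simpa [sq] using tendsto_osPointKernel_cfg4 hΔ h8 hb hbi hb hbi (τ := τ))
  rwa [osSym_empty S hR, osSym_empty S hR] at key

/-- … with a constant of modulus at most `1`. [folklore] -/
theorem wick8_ratio_sq_le_one {S : CorrFamily 3} {Δ : ℝ} (hΔ : 0 < Δ)
    (hRP : IsReflectionPositiveAlong τ S) (hT : IsTranslationInvariant S)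
    (hR : IsReflectionInvariantAlong τ S) (h0 : ∀ x, S 0 x = 1)
    (h8 : ∀ x : Fin 8 → E³, Function.Injective x → S 8 x = wick8 Δ x)
    {a : Fin 4 → E³} (ha : ∀ i, 0 < a i τ) (hai : Function.Injective a) :
    (S 4 a / wick Δ a) ^ 2 ≤ 1 := by
  have key := ratio_sq_le_one hRP (osPointKernel_empty_empty S h0) (cfg4 a ha hai)
    (wick_pos_of_injective Δ hai).ne' (fun L hL => osSym_empty_timeShift S hT hR _ hL)
    (by simpa [sq] using tendsto_osPointKernel_cfg4 hΔ h8 ha hai ha hai (τ := τ))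
  rwa [osSym_empty S hR] at key

/-- **`S₈` Gaussian ⇒ `S₄ = γ · wick Δ` on ALL non-coincident configurations, `γ² ≤ 1`.** [folklore] -/
theorem exists_gamma_four_point_of_wick_eight {S : CorrFamily 3} {Δ : ℝ} (hΔ : 0 < Δ) (τ : Fin 3)
    (hRP : IsReflectionPositiveAlong τ S) (hT : IsTranslationInvariant S)
    (hR : IsReflectionInvariantAlong τ S) (h0 : ∀ x, S 0 x = 1)
    (h8 : ∀ x : Fin 8 → E³, Function.Injective x → S 8 x = wick8 Δ x) :
    ∃ γ : ℝ, γ ^ 2 ≤ 1 ∧ ∀ x : Fin 4 → E³, Function.Injective x → S 4 x = γ * wick Δ x := by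
  -- reference configuration `(e, 2e, 3e, 4e)` on the axis `τ`
  set r : Fin 4 → E³ := fun i => EuclideanSpace.single τ (((i : ℕ) : ℝ) + 1) with hr
  have hrpos : ∀ i, 0 < r i τ := fun i => by simp [hr]; positivity
  have hrinj : Function.Injective r := by
    intro i j hij
    have h : ((i : ℕ) : ℝ) + 1 = ((j : ℕ) : ℝ) + 1 := by
      simpa [hr] using congrArg (fun z : E³ => z τ) hij
    exact Fin.ext (Nat.cast_injective (R := ℝ) (by linarith))
  refine ⟨S 4 r / wick Δ r, wick8_ratio_sq_le_one hΔ hRP hT hR h0 h8 hrpos hrinj, ?_⟩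
  intro x hx
  -- translate `x` up by `t e_τ`, `t = 1 + ∑ |x i τ|`
  set t : ℝ := 1 + ∑ i, |x i τ| with ht
  set w : E³ := EuclideanSpace.single τ t with hw
  have hxpos : ∀ i, 0 < (x i + w) τ := by
    intro i
    simp only [PiLp.add_apply, hw, PiLp.single_apply, if_true]
    have h1 : |x i τ| ≤ ∑ j, |x j τ| :=
      Finset.single_le_sum (f := fun j => |x j τ|) (fun j _ => abs_nonneg _) (Finset.mem_univ i)
    have h2 := neg_abs_le (x i τ)
    linarith
  have hxinj : Function.Injective (fun i => x i + w) := fun i j hij => hx (add_right_cancel hij)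
  have key := wick8_downward_four hΔ hRP hT hR h0 h8 hxpos hxinj hrpos hrinj
  have hS : S 4 (fun i => x i + w) = S 4 x := hT 4 w x
  have hW : wick Δ (fun i => x i + w) = wick Δ x := by simp only [wick, twoPt_add]
  rw [hS, hW] at key
  rw [← key, div_mul_cancel₀ _ (wick_pos_of_injective Δ hx).ne']

/-- **Hence the inversion identity AT ORDER FOUR** for such a family, once it is normalised to `0`
on coincident configurations (as the crux's `S` is): `S₈` Gaussian + RP ⇒ `S₄` inversion covariant
with weight `Δ`. An RP decoy for the crux cannot be Gaussian at order eight. [folklore] -/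
theorem invIdentity_four_of_wick_eight {S : CorrFamily 3} {Δ : ℝ} (hΔ : 0 < Δ) (τ : Fin 3)
    (hRP : IsReflectionPositiveAlong τ S) (hT : IsTranslationInvariant S)
    (hR : IsReflectionInvariantAlong τ S) (h0 : ∀ x, S 0 x = 1)
    (hnorm : ∀ x : Fin 4 → E³, ¬ Function.Injective x → S 4 x = 0)
    (h8 : ∀ x : Fin 8 → E³, Function.Injective x → S 8 x = wick8 Δ x)
    (x : Fin 4 → E³) (hx : ∀ i, x i ≠ 0) :
    S 4 (fun i => inversion 0 1 (x i)) = (∏ i, ‖x i‖ ^ (2 * Δ)) * S 4 x := by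
  obtain ⟨γ, -, hγ⟩ := exists_gamma_four_point_of_wick_eight hΔ τ hRP hT hR h0 h8
  by_cases hinj : Function.Injective x
  · rw [hγ x hinj, hγ _ (injective_inversion_comp_iff.2 hinj), wick_inversion Δ hx]
    ring
  · have h' : ¬ Function.Injective (fun i => inversion (0 : E³) 1 (x i)) :=
      fun h => hinj (injective_inversion_comp_iff.1 h)
    rw [hnorm x hinj, hnorm _ h', mul_zero]

end Summit.CriticalPhenomena.Ising3DConformalLimit.InversionUpgradeNormalisedNegative

end
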